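import Literature.NumberTheory.DiophantineApproximation.ApproximationByAlgebraicNumbersProofs
import Summits.Schanuel.Schanuel.Theorems.DiophantineDichotomyApproximationPropertyCleanClusterLeverLemmas

/-!
# Clean one-dimensional cluster lever (crux `ApproximationProperty`, stub `cleanClusterLever`)

Crux `stmt-Schanuel-6117` (`Summit.Schanuel.Schanuel.Theses.DiophantineDichotomy.ApproximationProperty`),
line `orbit-interpolation-determinant`; this file proves the registered stub `cleanClusterLever`:
for an irreducible `P ∈ ℤ[X]` of degree `D ≥ 2`, `0 < r ≤ 1/(4D)` and `k` the number of complex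
roots of `P` in the disc `‖z - x‖ ≤ r`,
`k(k-1) log(1/(2r)) ≤ 4 (D log D + k² log(eD) + (D-1) log M(P_ℂ) + k)` — a cluster bound WITHOUT
the `k·D·log(2+|x|)` term of the general lever `stub_orbitClusterBound`. Everything here is PROVED;
no definitions, no named facts.

Proof. (1) `P_ℂ` is separable with `D` distinct roots and `1 ≤ a^{2D-1} ‖V‖²` for the Vandermonde
determinant `V` of the roots, `a = |lead P|` (the resultant `Res(P, P') ∈ ℤ ∖ 0`; Bugeaud, Lemma A.8,
`Literature…IntegerPolynomialRootDistance.roots_data`), `M(P_ℂ) = a ∏ max(1, |root|)`;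
`CleanClusterLever.roots_enum` enumerates the roots with the `k` clustered ones first.
(2) Newton divided differences on the `k` cluster rows (`cleanClusterLever_vandermonde` of the lemmas
file): `‖V‖ ≤ ∏_{l<i<k} ‖ζ_i - ζ_l‖ · D! · ∏_{i<k} D^i ρ^{D-1} · ∏_{i≥k} max(1,‖ζ_i‖)^{D-1}` with
`ρ = max_{i<k} max(1, ‖ζ_i‖)`. (3) Cluster points are `2r`-close, so the first product is
`≤ (2r)^{k(k-1)/2}` and `ρ ≤ (1 + 2r) max(1, ‖ζ_i‖)` for `i < k`; Mahler bookkeeping turns the row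
bounds into `D^{k(k-1)/2} (1+2r)^{k(D-1)} (M/a)^{D-1}`, whence
`1 ≤ a M^{2(D-1)} (2r)^{k(k-1)} (D!)² D^{k(k-1)} (1+2r)^{2k(D-1)}`; taking logarithms
(`D! ≤ D^D`, `log(1+2r) ≤ 2r`, `4r(D-1) ≤ 1`, `a ≤ M`) gives the claim with room to spare.

Sources: the card `orbit-interpolation-determinant`; Y. Bugeaud, *Approximation by Algebraic Numbers*
(CUP 2004), Lemma A.8 [Bugeaud2004]; M. Laurent, D. Roy, Ann. Inst. Fourier 49 (1999), Lemmas 3–4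
(the `t = 1` discriminant device).
-/

set_option linter.dupNamespace false

namespace Summit.Schanuel.Schanuel.Cruxes.ApproximationProperty.OrbitInterpolationDeterminant

open Polynomial Finset
open scoped BigOperators

namespace CleanClusterLever

/-! ## Root data of an irreducible integer polynomial, cluster first -/

/-- **Root data, enumerated with a cluster first.** For an irreducible `P ∈ ℤ[X]` of degree
`D ≥ 2` (so `P_ℂ` is separable with `D` distinct roots), the roots can be enumerated
`ζ₀, …, ζ_{D-1}` with the `k` roots of the disc `‖z - x‖ ≤ r` first; `a = ‖lead P_ℂ‖ ≥ 1`,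
`M(P_ℂ) = a ∏ max(1, ‖ζ_i‖)`, and the resultant bound `1 ≤ a^{2D-1} ‖V(ζ)‖²` (Bugeaud, Lemma A.8,
via `roots_data`). [cite: Bugeaud2004, Lemma A.8 proof] -/
theorem roots_enum (P : ℤ[X]) (x : ℂ) (r : ℝ) (hirr : Irreducible P) (hdeg : 2 ≤ P.natDegree) :
    ∃ ζ : ℕ → ℂ,
      ((P.map (Int.castRingHom ℂ)).roots.filter (fun z => ‖z - x‖ ≤ r)).card ≤ P.natDegree ∧
      (∀ l < ((P.map (Int.castRingHom ℂ)).roots.filter (fun z => ‖z - x‖ ≤ r)).card,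
        ‖ζ l - x‖ ≤ r) ∧
      1 ≤ ‖(P.map (Int.castRingHom ℂ)).leadingCoeff‖ ∧
      (P.map (Int.castRingHom ℂ)).mahlerMeasure =
        ‖(P.map (Int.castRingHom ℂ)).leadingCoeff‖ * ∏ i ∈ range P.natDegree, max 1 ‖ζ i‖ ∧
      1 ≤ ‖(P.map (Int.castRingHom ℂ)).leadingCoeff‖ ^ (2 * P.natDegree - 1) *
        ‖(Matrix.vandermonde (fun i : Fin P.natDegree => ζ i)).det‖ ^ 2 := by
  classical
  set p := P.map (Int.castRingHom ℂ) with hp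
  set D := P.natDegree with hD
  have hsep : p.Separable :=
    Literature.NumberTheory.DiophantineApproximation.separable_map_of_irreducible P hirr (by omega)
  obtain ⟨hcard, ha, -, -, hM, hR⟩ :=
    Literature.NumberTheory.DiophantineApproximation.roots_data P (by omega) hsep x
  set S := p.roots.toFinset with hS
  set C := S.filter (fun z => ‖z - x‖ ≤ r) with hC
  have hk : (p.roots.filter (fun z => ‖z - x‖ ≤ r)).card = C.card := by
    rw [hC, Finset.card_def, Finset.filter_val, hS, Multiset.toFinset_val, (nodup_roots hsep).dedup]
  rw [hk]
  have hCS : C ⊆ S := filter_subset _ _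
  have hkD : C.card ≤ D := (card_le_card hCS).trans hcard.le
  -- enumerate `S` with `C` first
  let f : Fin D → ℂ := fun i => if h : (i : ℕ) < C.card then (C.equivFin.symm ⟨i, h⟩ : ℂ) else 0
  have hfC : ∀ i : Fin D, (i : ℕ) < C.card → f i ∈ C := fun i h => by
    simp only [f, dif_pos h]; exact Finset.coe_mem _
  obtain ⟨g, hg⟩ := Finset.exists_equiv_extend_of_card_eq (α := Fin D) (t := S)
    (by rw [Fintype.card_fin, hcard]) (s := univ.filter fun i : Fin D => (i : ℕ) < C.card) (f := f)
    (fun z hz => by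
      obtain ⟨i, hi, rfl⟩ := mem_image.1 hz
      exact hCS (hfC i (mem_filter.1 hi).2))
    (fun i hi i' hi' h => by
      have hi := (mem_filter.1 hi).2
      have hi' := (mem_filter.1 hi').2
      simp only [f, dif_pos hi, dif_pos hi'] at h
      have h2 := C.equivFin.symm.injective (Subtype.val_injective h)
      exact Fin.ext (Fin.mk.inj_iff.1 h2))
  set ζ : ℕ → ℂ := fun l => if h : l < D then (g ⟨l, h⟩ : ℂ) else 0 with hζ
  have hζg : ∀ i : Fin D, ζ i = g i := fun i => by simp only [hζ, dif_pos i.isLt, Fin.eta]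
  have htr : ∀ F : ℂ → ℝ, ∏ β ∈ S, F β = ∏ i ∈ range D, F (ζ i) := by
    intro F
    rw [← Fin.prod_univ_eq_prod_range (fun l => F (ζ l)) D, ← prod_coe_sort S,
      ← Equiv.prod_comp g (fun b : S => F b)]
    exact Fintype.prod_congr _ _ fun i => by rw [hζg]
  refine ⟨ζ, hkD, ?_, ha, by rw [hM, htr], ?_⟩
  · intro l hl
    have hlD : l < D := lt_of_lt_of_le hl hkD
    rw [hζg ⟨l, hlD⟩, hg ⟨l, hlD⟩ (mem_filter.2 ⟨mem_univ _, hl⟩)]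
    exact (mem_filter.1 (hfC ⟨l, hlD⟩ hl)).2
  · -- the double product of root differences is `‖V‖²`
    set v : Fin D → ℂ := fun i => ζ i with hv
    have hvinj : Function.Injective v := fun i i' h => by
      rw [hv] at h
      simp only [hζg] at h
      exact g.injective (Subtype.val_injective h)
    have hSv : S = univ.image v := by
      ext β
      simp only [mem_image, mem_univ, true_and]
      constructor
      · intro hβ
        exact ⟨g.symm ⟨β, hβ⟩, by rw [hv]; simp only [hζg, Equiv.apply_symm_apply]⟩
      · rintro ⟨i, rfl⟩
        rw [hv]; simp only [hζg]; exact (g i).2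
    have hprod : ∏ β ∈ S, ∏ γ ∈ S.erase β, ‖β - γ‖ = ‖(Matrix.vandermonde v).det‖ ^ 2 := by
      rw [← Literature.NumberTheory.DiophantineApproximation.prod_prod_norm_sub_eq_norm_det_vandermonde_sq,
        hSv, prod_image fun i _ i' _ h => hvinj h]
      refine prod_congr rfl fun i _ => ?_
      rw [← Finset.image_erase hvinj, prod_image fun i _ i' _ h => hvinj h]
    rw [hcard, hprod] at hR
    exact hR

/-! ## Assembly -/

/-- **The clean cluster lever** (curried form of the registered stub): for irreducible
`P ∈ ℤ[X]` of degree `D ≥ 2`, `0 < r ≤ 1/(4D)` and `k` roots of `P` in the disc `‖z - x‖ ≤ r`,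
`k(k-1) log(1/(2r)) ≤ 4 (D log D + k² log(eD) + (D-1) log M(P) + k)`. Discriminant (resultant)
`≥ 1`, Newton divided differences on the cluster rows of the Vandermonde, Leibniz, Mahler
bookkeeping. [folklore] -/
theorem lever (P : ℤ[X]) (x : ℂ) (r : ℝ) (k : ℕ) (hirr : Irreducible P) (hdeg : 2 ≤ P.natDegree)
    (hr : 0 < r) (hr4 : r * (4 * (P.natDegree : ℝ)) ≤ 1)
    (hk : k = ((P.map (Int.castRingHom ℂ)).roots.filter (fun z => ‖z - x‖ ≤ r)).card) :
    (k : ℝ) * ((k : ℝ) - 1) * Real.log (1 / (2 * r)) ≤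
      4 * ((P.natDegree : ℝ) * Real.log (P.natDegree : ℝ) +
        (k : ℝ) ^ 2 * Real.log (Real.exp 1 * (P.natDegree : ℝ)) +
        ((P.natDegree : ℝ) - 1) * Real.log (P.map (Int.castRingHom ℂ)).mahlerMeasure + (k : ℝ)) := by
  obtain ⟨ζ, hkD, hclus, ha, hM, hR⟩ := roots_enum P x r hirr hdeg
  rw [← hk] at hkD hclus
  set D := P.natDegree with hD
  set a := ‖(P.map (Int.castRingHom ℂ)).leadingCoeff‖ with haD
  set M := (P.map (Int.castRingHom ℂ)).mahlerMeasure with hMD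
  -- basic real facts
  have hD1 : (1 : ℝ) ≤ D := by exact_mod_cast (by omega : 1 ≤ D)
  have hlogD : 0 ≤ Real.log D := Real.log_nonneg hD1
  have hμ1 : ∀ i, (1 : ℝ) ≤ max 1 ‖ζ i‖ := fun i => le_max_left _ _
  have hPμ1 : (1 : ℝ) ≤ ∏ i ∈ range D, max 1 ‖ζ i‖ := one_le_prod fun i _ => hμ1 i
  have haM : a ≤ M := by rw [hM]; exact le_mul_of_one_le_right (by positivity) hPμ1
  have hM1 : 1 ≤ M := ha.trans haM
  have hlogM : 0 ≤ Real.log M := Real.log_nonneg hM1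
  have hlogaM : Real.log a ≤ Real.log M := Real.log_le_log (by positivity) haM
  have hlogeD : Real.log (Real.exp 1 * D) = 1 + Real.log D := by
    rw [Real.log_mul (Real.exp_pos 1).ne' (by positivity), Real.log_exp]
  -- the trivial case `k = 0`
  rcases Nat.eq_zero_or_pos k with hk0 | hkpos
  · subst hk0
    simp only [Nat.cast_zero, zero_mul, zero_pow two_ne_zero, add_zero]
    have h1 : 0 ≤ ((D : ℝ) - 1) * Real.log M := mul_nonneg (by linarith) hlogM
    have h2 : 0 ≤ (D : ℝ) * Real.log D := mul_nonneg (by linarith) hlogD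
    linarith
  -- the radius `ρ = max_{i<k} max(1, ‖ζ_i‖)`
  obtain ⟨m₀, hm₀, hmax⟩ :=
    exists_max_image (range k) (fun i => max 1 ‖ζ i‖) (nonempty_range_iff.2 hkpos.ne')
  set ρ := max 1 ‖ζ m₀‖ with hρ
  have hρ1 : 1 ≤ ρ := le_max_left _ _
  have hζρ : ∀ l < k, ‖ζ l‖ ≤ ρ := fun l hl =>
    (le_max_right _ _).trans (hmax l (mem_range.2 hl))
  have hm₀k : m₀ < k := mem_range.1 hm₀
  -- cluster points are `2r`-close, hence `ρ ≤ (1 + 2r) max(1, ‖ζ_i‖)` on the cluster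
  have hclose : ∀ i < k, ∀ l < k, ‖ζ i - ζ l‖ ≤ 2 * r := fun i hi l hl =>
    calc ‖ζ i - ζ l‖ = ‖(ζ i - x) - (ζ l - x)‖ := by ring_nf
      _ ≤ ‖ζ i - x‖ + ‖ζ l - x‖ := norm_sub_le _ _
      _ ≤ r + r := add_le_add (hclus i hi) (hclus l hl)
      _ = 2 * r := by ring
  have hρμ : ∀ i < k, ρ ≤ (1 + 2 * r) * max 1 ‖ζ i‖ := by
    intro i hi
    have h1 : ‖ζ m₀‖ ≤ ‖ζ i‖ + 2 * r :=
      calc ‖ζ m₀‖ = ‖ζ i + (ζ m₀ - ζ i)‖ := by ring_nf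
        _ ≤ ‖ζ i‖ + ‖ζ m₀ - ζ i‖ := norm_add_le _ _
        _ ≤ ‖ζ i‖ + 2 * r := by gcongr; exact hclose m₀ hm₀k i hi
    have h2 : ρ ≤ max 1 ‖ζ i‖ + 2 * r := by
      rw [hρ]
      refine max_le ?_ ?_
      · linarith [hμ1 i]
      · exact h1.trans (by gcongr; exact le_max_right _ _)
    have h3 : 2 * r ≤ 2 * r * max 1 ‖ζ i‖ := le_mul_of_one_le_right (by positivity) (hμ1 i)
    linarith
  -- the divided-difference Vandermonde bound
  have hV := cleanClusterLever_vandermonde D k hkD ζ ρ hρ1 hζρ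
  set T := ∑ i ∈ range k, i with hT
  have hdiff : ∏ i ∈ range k, ∏ l ∈ range i, ‖ζ i - ζ l‖ ≤ (2 * r) ^ T := by
    rw [hT, ← prod_pow_eq_pow_sum]
    refine prod_le_prod (fun i _ => prod_nonneg fun l _ => norm_nonneg _) fun i hi => ?_
    calc ∏ l ∈ range i, ‖ζ i - ζ l‖ ≤ ∏ _l ∈ range i, (2 * r) :=
          prod_le_prod (fun l _ => norm_nonneg _) fun l hl =>
            hclose i (mem_range.1 hi) l ((mem_range.1 hl).trans (mem_range.1 hi))
      _ = (2 * r) ^ i := by rw [prod_const, card_range]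
  have hρ0 : (0 : ℝ) ≤ ρ := zero_le_one.trans hρ1
  have hrows : ∏ i ∈ range D,
      (if i < k then (D : ℝ) ^ i * ρ ^ (D - 1) else max 1 ‖ζ i‖ ^ (D - 1)) ≤
        (D : ℝ) ^ T * (1 + 2 * r) ^ (k * (D - 1)) * (∏ i ∈ range D, max 1 ‖ζ i‖) ^ (D - 1) := by
    have hG : ∏ i ∈ range D, (if i < k then (D : ℝ) ^ i * (1 + 2 * r) ^ (D - 1) else 1) =
        (D : ℝ) ^ T * (1 + 2 * r) ^ (k * (D - 1)) := by
      rw [← prod_range_mul_prod_Ico _ hkD, prod_eq_one (s := Ico k D) fun i hi => by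
        rw [if_neg (not_lt.2 (mem_Ico.1 hi).1)], mul_one,
        prod_congr rfl fun i hi => if_pos (mem_range.1 hi), prod_mul_distrib, prod_pow_eq_pow_sum,
        prod_const, card_range, ← pow_mul, ← hT, mul_comm (D - 1) k]
    calc _ ≤ ∏ i ∈ range D, ((if i < k then (D : ℝ) ^ i * (1 + 2 * r) ^ (D - 1) else 1) *
          max 1 ‖ζ i‖ ^ (D - 1)) := by
          refine prod_le_prod (fun i _ => ?_) fun i _ => ?_
          · split_ifs <;> positivity
          · split_ifs with hi
            · rw [mul_assoc, ← mul_pow]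
              exact mul_le_mul_of_nonneg_left (pow_le_pow_left₀ hρ0 (hρμ i hi) _) (by positivity)
            · rw [one_mul]
      _ = _ := by rw [prod_mul_distrib, hG, prod_pow]
  -- combine into one multiplicative inequality
  have hdet : ‖(Matrix.vandermonde (fun i : Fin D => ζ i)).det‖ ≤
      (2 * r) ^ T * (D.factorial * ((D : ℝ) ^ T * (1 + 2 * r) ^ (k * (D - 1)) *
        (∏ i ∈ range D, max 1 ‖ζ i‖) ^ (D - 1))) :=
    hV.trans (mul_le_mul hdiff (mul_le_mul_of_nonneg_left hrows (by positivity))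
      (mul_nonneg (by positivity) (prod_nonneg fun i _ => by split_ifs <;> positivity))
      (by positivity))
  have hmain : 1 ≤ a * M ^ (2 * (D - 1)) *
      ((2 * r) ^ T * (D.factorial * ((D : ℝ) ^ T * (1 + 2 * r) ^ (k * (D - 1))))) ^ 2 := by
    have h2D : 2 * D - 1 = 2 * (D - 1) + 1 := by omega
    calc (1 : ℝ) ≤ a ^ (2 * D - 1) * ‖(Matrix.vandermonde (fun i : Fin D => ζ i)).det‖ ^ 2 := hR
      _ ≤ a ^ (2 * D - 1) * ((2 * r) ^ T * (D.factorial * ((D : ℝ) ^ T *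
            (1 + 2 * r) ^ (k * (D - 1)) * (∏ i ∈ range D, max 1 ‖ζ i‖) ^ (D - 1)))) ^ 2 := by
          gcongr
      _ = _ := by rw [hM, h2D]; ring
  -- take logarithms
  have hfact : Real.log (D.factorial : ℝ) ≤ D * Real.log D := by
    rw [← Real.log_pow]
    exact Real.log_le_log (by positivity) (by exact_mod_cast Nat.factorial_le_pow D)
  have hlog1r : Real.log (1 + 2 * r) ≤ 2 * r := by
    have := Real.log_le_sub_one_of_pos (by positivity : (0 : ℝ) < 1 + 2 * r); linarith
  have hT2 : (2 : ℝ) * T = k * ((k : ℝ) - 1) := by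
    have h := sum_range_id_mul_two k
    rw [← hT] at h
    have h' : ((T * 2 : ℕ) : ℝ) = ((k * (k - 1) : ℕ) : ℝ) := by rw [h]
    push_cast [Nat.cast_sub hkpos] at h'
    linarith
  have hlog := Real.log_nonneg hmain
  rw [Real.log_mul (by positivity) (by positivity), Real.log_mul (by positivity) (by positivity),
    Real.log_pow _ 2, Real.log_mul (by positivity) (by positivity),
    Real.log_mul (by positivity) (by positivity), Real.log_mul (by positivity) (by positivity),
    Real.log_pow, Real.log_pow, Real.log_pow, Real.log_pow] at hlog
  push_cast [Nat.cast_sub (by omega : 1 ≤ D)] at hlog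
  rw [one_div, Real.log_inv, hlogeD]
  -- linear bookkeeping
  have hK0 : (0 : ℝ) ≤ k := Nat.cast_nonneg _
  have hD2 : (2 : ℝ) ≤ D := by exact_mod_cast hdeg
  have g1 : (k : ℝ) * ((D : ℝ) - 1) * Real.log (1 + 2 * r) ≤ (k : ℝ) * ((D : ℝ) - 1) * (2 * r) :=
    mul_le_mul_of_nonneg_left hlog1r (mul_nonneg hK0 (by linarith))
  have g2 : (k : ℝ) * (4 * r * ((D : ℝ) - 1)) ≤ (k : ℝ) * 1 :=
    mul_le_mul_of_nonneg_left (by linarith) hK0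
  have g3 : (k : ℝ) * ((k : ℝ) - 1) * Real.log D ≤ 4 * (k : ℝ) ^ 2 * Real.log D :=
    mul_le_mul_of_nonneg_right (by nlinarith [sq_nonneg (k : ℝ)]) hlogD
  have g4 : Real.log M ≤ 2 * ((D : ℝ) - 1) * Real.log M :=
    le_mul_of_one_le_left hlogM (by linarith)
  have g5 : (2 : ℝ) * T * Real.log (2 * r) = k * ((k : ℝ) - 1) * Real.log (2 * r) := by rw [hT2]
  have g6 : (2 : ℝ) * T * Real.log D = k * ((k : ℝ) - 1) * Real.log D := by rw [hT2]
  have g7 : 0 ≤ (D : ℝ) * Real.log D := mul_nonneg (by linarith) hlogD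
  have g8 : 0 ≤ (k : ℝ) ^ 2 := sq_nonneg _
  linarith [g1, g2, g3, g4, g5, g6, g7, g8, hfact, hlogaM, hlog, hlogD, hlogM, hK0]

end CleanClusterLever

/-- **Clean one-dimensional cluster lever** (registered stub `cleanClusterLever` of the line
`orbit-interpolation-determinant`): for an irreducible `P ∈ ℤ[X]` of degree `D ≥ 2`,
`0 < r ≤ 1/(4D)` and `k` the number of complex roots of `P` in the disc `‖z - x‖ ≤ r`,
`k(k-1) log(1/(2r)) ≤ 4 (D log D + k² log(eD) + (D-1) log M(P_ℂ) + k)` — no `k·D`-term.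
[folklore] -/
theorem cleanClusterLever : ∀ (P : Polynomial ℤ) (x : ℂ) (r : ℝ) (k : ℕ), Irreducible P → 2 ≤ P.natDegree → 0 < r → r * (4 * (P.natDegree : ℝ)) ≤ 1 → k = (((P.map (Int.castRingHom ℂ)).roots.filter (fun z => ‖z - x‖ ≤ r)).card) → (k : ℝ) * ((k : ℝ) - 1) * Real.log (1 / (2 * r)) ≤ 4 * ((P.natDegree : ℝ) * Real.log (P.natDegree : ℝ) + (k : ℝ) ^ 2 * Real.log (Real.exp 1 * (P.natDegree : ℝ)) + ((P.natDegree : ℝ) - 1) * Real.log (P.map (Int.castRingHom ℂ)).mahlerMeasure + (k : ℝ)) := by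
  intro P x r k hirr hdeg hr hr4 hk
  exact CleanClusterLever.lever P x r k hirr hdeg hr hr4 hk

end Summit.Schanuel.Schanuel.Cruxes.ApproximationProperty.OrbitInterpolationDeterminant
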